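import Mathlib
import Summits.Ventures.PercRepro2.Defs
import Summits.Ventures.PercRepro2.Independence
import Summits.Ventures.PercRepro2.Harris
import Summits.Ventures.PercRepro2.Graph
import Summits.Ventures.PercRepro2.Exploration
import Summits.Ventures.PercRepro2.Events
import Summits.Ventures.PercRepro2.FourFunctions
import Summits.Ventures.PercRepro2.Induced
import Summits.Ventures.PercRepro2.Frontier
import Summits.Ventures.PercRepro2.ObsIndependence
import Summits.Ventures.PercRepro2.BHK
import Summits.Ventures.PercRepro2.BHKEvents
import Summits.Ventures.PercRepro2.MultiSource
import Summits.Ventures.PercRepro2.OrderPreservation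
import Summits.Ventures.PercRepro2.SeedSet
import Summits.Ventures.PercRepro2.MultiSourceFun
import Summits.Ventures.PercRepro2.CrossRootT
import Summits.Ventures.PercRepro2.VdBKahn
import Summits.Ventures.PercRepro2.HullDefs
import Summits.Ventures.PercRepro2.CCTRootEdge
import Summits.Ventures.PercRepro2.CCTAvoidedEdge
import Summits.Ventures.PercRepro2.R1Rung
import Summits.Ventures.PercRepro2.CC2Rung
import Summits.Ventures.PercRepro2.PASubDefs
import Summits.Ventures.PercRepro2.HalfN
import Summits.Ventures.PercRepro2.CCTLin
import Summits.Ventures.PercRepro2.L1SDefs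
import Summits.Ventures.PercRepro2.L1SDel

/-!
# (L1-S) ⟹ (CC-T): the S-frame reduction is rigorous (blind cell PercRepro2, typer-1; mine-c g3
MINE-C.md §10.3 "by BHK 1.3 in `G − S` (root `w`, avoided `T`, `x(S ∪ ·)` increasing),
`Cov_{μ₁}(X⁺, Y⁺ | S) ≥ 0`, so (L1-S) ⟹ (CC-T), and (L1-S) is STRICTLY STRONGER")

The joint `e`-open mass `A₁ = P(X⁺ ∩ Y⁺ ∩ R⁺)` dominates the linearised one
`Ã₁ = Σ_W P(X⁺ ∩ R⁺ ∩ {S = W}) P(Y⁺ ∩ R⁺ ∩ {S = W}) / P(R⁺ ∩ {S = W})` termwise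
(`linJoint_le`), because for every `W`

`P(X⁺ ∩ R⁺ ∩ {S = W}) · P(Y⁺ ∩ R⁺ ∩ {S = W}) ≤ P(X⁺ ∩ Y⁺ ∩ R⁺ ∩ {S = W}) · P(R⁺ ∩ {S = W})`
(`term_le`):

* `s ∉ W` or `W ∩ T ≠ ∅`: every term vanishes;
* both ends of `e` in `W` or both outside: the `e`-open cluster is `W` and the terms are
  deterministic on `{S = W}` — equality (`term_le_of_both`);
* the **merge class** `e = {u, w}`, `u ∈ W ∌ w`: the `e`-open cluster is `W ∪ C_{G−W}(w)`
  (`cluster_update_true_eq_union_of_merge`), the `G − W` events are independent of `{S = W}`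
  (edges off / on `W`), and van den Berg–Häggström–Kahn on the induced subgraph `G[Wᶜ]`
  (`bhk_induced`, carried to `G − W` by `delConfig_eq_induced`) gives the inequality for the
  cluster of `w` avoiding `T` with the up-sets `{C ∣ a ∈ W ∨ a ∈ C}` (`term_le_of_merge`).

Hence **`CC2_of_L1S`**: `L1S p ends e s T a b → TwoSetRung.CC2 p ends e s {a} {b} T T` — the S-frame
twin of `CCTLin.CC2_of_L1K`.
-/

namespace Summit.Ventures.PercRepro2

namespace SFrame

open PASub CCTLin TwoSetRung

open scoped Classical

variable {V : Type*} {E : Type*} [Fintype E] [DecidableEq E] [Fintype V] [DecidableEq V]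
  {R : Type*} [Field R] [LinearOrder R] [IsStrictOrderedRing R]

/-! ## The termwise inequality -/

section Termwise

variable (p : E → R) (ends : E → Sym2 V) (e : E) (s : V) (T : Finset V)

/-- The up-set `{C ∣ a ∈ W ∨ a ∈ C}` (`a ∈ W ∪ C`). -/
def upA (W : Set V) (a : V) : Set (Set V) := {C | a ∈ W ∨ a ∈ C}

omit [Fintype E] [DecidableEq E] [Fintype V] [DecidableEq V] in
/-- `upA W a` is an up-set. -/
lemma isUpperSet_upA (W : Set V) (a : V) : IsUpperSet (upA W a) := by
  intro C C' hCC' hC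
  rcases hC with h | h
  · exact Or.inl h
  · exact Or.inr (hCC' h)

omit [Fintype E] [Fintype V] [DecidableEq V] in
/-- Merge class: `X⁺ ∩ R⁺ ∩ {S = W} = ({C_{G−W}(w) ∈ 𝓤_a} ∩ {C_{G−W}(w) ∩ T = ∅}) ∩ {S = W}`. -/
lemma Xplus_inter_Rplus_inter_SEvent_eq {u w : V} (hends : ends e = s(u, w)) {W : Set V}
    (hu : u ∈ W) (hw : w ∉ W) (hT : ∀ t ∈ T, t ∉ W) (a : V) :
    Xplus ends e s a ∩ Rplus ends e s T ∩ SEvent ends e s W =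
      (delClusterIn ends W w (upA W a) ∩ delAvoid ends W w T) ∩ SEvent ends e s W := by
  ext ω
  simp only [Set.mem_inter_iff]
  constructor
  · rintro ⟨⟨hX, hR⟩, hS⟩
    have hS' : cluster ends (Function.update ω e false) s = W := hS
    exact ⟨⟨(mem_Xplus_iff_of_merge ends s hends hS' hu hw a).1 hX,
      (mem_Rplus_iff_of_merge ends s hends hS' hu hw hT).1 hR⟩, hS⟩
  · rintro ⟨⟨hX, hR⟩, hS⟩
    have hS' : cluster ends (Function.update ω e false) s = W := hS
    exact ⟨⟨(mem_Xplus_iff_of_merge ends s hends hS' hu hw a).2 hX,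
      (mem_Rplus_iff_of_merge ends s hends hS' hu hw hT).2 hR⟩, hS⟩

omit [Fintype E] [Fintype V] [DecidableEq V] in
/-- Merge class: the pair version. -/
lemma Xplus_inter_Xplus_inter_Rplus_inter_SEvent_eq {u w : V} (hends : ends e = s(u, w))
    {W : Set V} (hu : u ∈ W) (hw : w ∉ W) (hT : ∀ t ∈ T, t ∉ W) (a b : V) :
    Xplus ends e s a ∩ Xplus ends e s b ∩ Rplus ends e s T ∩ SEvent ends e s W =
      (delClusterIn ends W w (upA W a) ∩ delClusterIn ends W w (upA W b) ∩ delAvoid ends W w T) ∩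
        SEvent ends e s W := by
  ext ω
  simp only [Set.mem_inter_iff]
  constructor
  · rintro ⟨⟨⟨hX, hY⟩, hR⟩, hS⟩
    have hS' : cluster ends (Function.update ω e false) s = W := hS
    exact ⟨⟨⟨(mem_Xplus_iff_of_merge ends s hends hS' hu hw a).1 hX,
      (mem_Xplus_iff_of_merge ends s hends hS' hu hw b).1 hY⟩,
      (mem_Rplus_iff_of_merge ends s hends hS' hu hw hT).1 hR⟩, hS⟩
  · rintro ⟨⟨⟨hX, hY⟩, hR⟩, hS⟩
    have hS' : cluster ends (Function.update ω e false) s = W := hS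
    exact ⟨⟨⟨(mem_Xplus_iff_of_merge ends s hends hS' hu hw a).2 hX,
      (mem_Xplus_iff_of_merge ends s hends hS' hu hw b).2 hY⟩,
      (mem_Rplus_iff_of_merge ends s hends hS' hu hw hT).2 hR⟩, hS⟩

omit [Fintype E] [Fintype V] [DecidableEq V] in
/-- Merge class: `R⁺ ∩ {S = W} = {C_{G−W}(w) ∩ T = ∅} ∩ {S = W}`. -/
lemma Rplus_inter_SEvent_eq {u w : V} (hends : ends e = s(u, w)) {W : Set V}
    (hu : u ∈ W) (hw : w ∉ W) (hT : ∀ t ∈ T, t ∉ W) :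
    Rplus ends e s T ∩ SEvent ends e s W = delAvoid ends W w T ∩ SEvent ends e s W := by
  ext ω
  simp only [Set.mem_inter_iff]
  constructor
  · rintro ⟨hR, hS⟩
    have hS' : cluster ends (Function.update ω e false) s = W := hS
    exact ⟨(mem_Rplus_iff_of_merge ends s hends hS' hu hw hT).1 hR, hS⟩
  · rintro ⟨hR, hS⟩
    have hS' : cluster ends (Function.update ω e false) s = W := hS
    exact ⟨(mem_Rplus_iff_of_merge ends s hends hS' hu hw hT).2 hR, hS⟩

omit [Fintype V] [DecidableEq V] [LinearOrder R] [IsStrictOrderedRing R] in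
/-- Independence of an event of `G − W` from `{S = W}`. -/
lemma prob_inter_SEvent_eq_mul {W : Set V} {A : Set (Config E)}
    (hA : DependsOn (· ∈ A) (touches ends W)ᶜ) :
    prob p (A ∩ SEvent ends e s W) = prob p A * prob p (SEvent ends e s W) :=
  prob_inter_eq_mul_of_dependsOn p (F₁ := (touches ends W)ᶜ) (F₂ := touches ends W)
    disjoint_compl_left hA (dependsOn_SEvent ends e s W)

omit [Fintype E] [DecidableEq E] [Fintype V] [DecidableEq V] in
/-- `{C ∈ 𝓤} ∩ {C ∩ T = ∅}` depends only on the edges off `W`. -/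
lemma dependsOn_delClusterIn_inter_delAvoid (W : Set V) (w : V) (𝓤 : Set (Set V)) :
    DependsOn (· ∈ delClusterIn ends W w 𝓤 ∩ delAvoid ends W w T) (touches ends W)ᶜ := by
  have h := dependsOn_inter (dependsOn_delClusterIn ends W w 𝓤) (dependsOn_delAvoid ends W w T)
  rwa [Set.union_self] at h

omit [Fintype E] [DecidableEq E] [Fintype V] [DecidableEq V] in
/-- `{C ∈ 𝓤} ∩ {C ∈ 𝓥} ∩ {C ∩ T = ∅}` depends only on the edges off `W`. -/
lemma dependsOn_delClusterIn_inter_delClusterIn_inter_delAvoid (W : Set V) (w : V)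
    (𝓤 𝓥 : Set (Set V)) :
    DependsOn (· ∈ delClusterIn ends W w 𝓤 ∩ delClusterIn ends W w 𝓥 ∩ delAvoid ends W w T)
      (touches ends W)ᶜ := by
  have h := dependsOn_inter (dependsOn_inter (dependsOn_delClusterIn ends W w 𝓤)
    (dependsOn_delClusterIn ends W w 𝓥)) (dependsOn_delAvoid ends W w T)
  rwa [Set.union_self, Set.union_self] at h

/-- **The termwise inequality in the merge class** (`u ∈ W ∌ w`): BHK on `G − W`. -/
lemma term_le_of_merge (hp : IsProbVec p) {u w : V} (hends : ends e = s(u, w)) {W : Set V}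
    (hu : u ∈ W) (hw : w ∉ W) (hT : ∀ t ∈ T, t ∉ W) (a b : V) :
    prob p (Xplus ends e s a ∩ Rplus ends e s T ∩ SEvent ends e s W) *
        prob p (Xplus ends e s b ∩ Rplus ends e s T ∩ SEvent ends e s W) ≤
      prob p (Xplus ends e s a ∩ Xplus ends e s b ∩ Rplus ends e s T ∩ SEvent ends e s W) *
        prob p (Rplus ends e s T ∩ SEvent ends e s W) := by
  rw [Xplus_inter_Rplus_inter_SEvent_eq ends e s T hends hu hw hT a,
    Xplus_inter_Rplus_inter_SEvent_eq ends e s T hends hu hw hT b,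
    Xplus_inter_Xplus_inter_Rplus_inter_SEvent_eq ends e s T hends hu hw hT a b,
    Rplus_inter_SEvent_eq ends e s T hends hu hw hT,
    prob_inter_SEvent_eq_mul p ends e s (dependsOn_delClusterIn_inter_delAvoid ends T W w _),
    prob_inter_SEvent_eq_mul p ends e s (dependsOn_delClusterIn_inter_delAvoid ends T W w _),
    prob_inter_SEvent_eq_mul p ends e s
      (dependsOn_delClusterIn_inter_delClusterIn_inter_delAvoid ends T W w _ _),
    prob_inter_SEvent_eq_mul p ends e s (dependsOn_delAvoid ends W w T)]
  have hbhk := bhk_del p ends W w T hp (isUpperSet_upA W a) (isUpperSet_upA W b) hT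
  have hS : 0 ≤ prob p (SEvent ends e s W) := prob_nonneg hp _
  calc prob p (delClusterIn ends W w (upA W a) ∩ delAvoid ends W w T) *
          prob p (SEvent ends e s W) *
        (prob p (delClusterIn ends W w (upA W b) ∩ delAvoid ends W w T) *
          prob p (SEvent ends e s W)) =
      (prob p (delClusterIn ends W w (upA W a) ∩ delAvoid ends W w T) *
          prob p (delClusterIn ends W w (upA W b) ∩ delAvoid ends W w T)) *
        (prob p (SEvent ends e s W) * prob p (SEvent ends e s W)) := by ring
    _ ≤ (prob p (delClusterIn ends W w (upA W a) ∩ delClusterIn ends W w (upA W b) ∩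
          delAvoid ends W w T) * prob p (delAvoid ends W w T)) *
        (prob p (SEvent ends e s W) * prob p (SEvent ends e s W)) :=
      mul_le_mul_of_nonneg_right hbhk (mul_nonneg hS hS)
    _ = _ := by ring

omit [Fintype V] [DecidableEq V] [IsStrictOrderedRing R] in
/-- **The termwise inequality when `e` does not cross the boundary of `W`**: the terms are
deterministic on `{S = W}`, equality holds. -/
lemma term_le_of_both {u w : V} (hends : ends e = s(u, w)) {W : Set V}
    (huw : u ∈ W ↔ w ∈ W) (hT : ∀ t ∈ T, t ∉ W) (a b : V) :
    prob p (Xplus ends e s a ∩ Rplus ends e s T ∩ SEvent ends e s W) *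
        prob p (Xplus ends e s b ∩ Rplus ends e s T ∩ SEvent ends e s W) ≤
      prob p (Xplus ends e s a ∩ Xplus ends e s b ∩ Rplus ends e s T ∩ SEvent ends e s W) *
        prob p (Rplus ends e s T ∩ SEvent ends e s W) := by
  have hX : ∀ c : V, Xplus ends e s c ∩ Rplus ends e s T ∩ SEvent ends e s W =
      if c ∈ W then SEvent ends e s W else ∅ := by
    intro c
    ext ω
    simp only [Set.mem_inter_iff]
    split_ifs with hc
    · constructor
      · rintro ⟨_, hS⟩; exact hS
      · intro hS
        have hS' : cluster ends (Function.update ω e false) s = W := hS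
        exact ⟨⟨(mem_Xplus_iff_of_both ends s hends hS' huw c).2 hc,
          (mem_Rplus_iff_of_both ends s hends hS' huw T).2 hT⟩, hS⟩
    · simp only [Set.mem_empty_iff_false, iff_false, not_and]
      intro hXR hS
      have hS' : cluster ends (Function.update ω e false) s = W := hS
      exact hc ((mem_Xplus_iff_of_both ends s hends hS' huw c).1 hXR.1)
  have hXY : Xplus ends e s a ∩ Xplus ends e s b ∩ Rplus ends e s T ∩ SEvent ends e s W =
      if a ∈ W ∧ b ∈ W then SEvent ends e s W else ∅ := by
    ext ω
    simp only [Set.mem_inter_iff]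
    split_ifs with hab
    · constructor
      · rintro ⟨_, hS⟩; exact hS
      · intro hS
        have hS' : cluster ends (Function.update ω e false) s = W := hS
        exact ⟨⟨⟨(mem_Xplus_iff_of_both ends s hends hS' huw a).2 hab.1,
          (mem_Xplus_iff_of_both ends s hends hS' huw b).2 hab.2⟩,
          (mem_Rplus_iff_of_both ends s hends hS' huw T).2 hT⟩, hS⟩
    · simp only [Set.mem_empty_iff_false, iff_false, not_and]
      intro hXYR hS
      have hS' : cluster ends (Function.update ω e false) s = W := hS
      exact hab ⟨(mem_Xplus_iff_of_both ends s hends hS' huw a).1 hXYR.1.1,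
        (mem_Xplus_iff_of_both ends s hends hS' huw b).1 hXYR.1.2⟩
  have hR : Rplus ends e s T ∩ SEvent ends e s W = SEvent ends e s W := by
    ext ω
    simp only [Set.mem_inter_iff]
    constructor
    · rintro ⟨_, hS⟩; exact hS
    · intro hS
      have hS' : cluster ends (Function.update ω e false) s = W := hS
      exact ⟨(mem_Rplus_iff_of_both ends s hends hS' huw T).2 hT, hS⟩
  rw [hX a, hX b, hXY, hR]
  by_cases ha : a ∈ W <;> by_cases hb : b ∈ W <;> simp [ha, hb, prob_empty]

/-- **The termwise inequality**, every `W`. -/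
lemma term_le (hp : IsProbVec p) {u w : V} (hends : ends e = s(u, w)) (a b : V) (W : Set V) :
    prob p (Xplus ends e s a ∩ Rplus ends e s T ∩ SEvent ends e s W) *
        prob p (Xplus ends e s b ∩ Rplus ends e s T ∩ SEvent ends e s W) ≤
      prob p (Xplus ends e s a ∩ Xplus ends e s b ∩ Rplus ends e s T ∩ SEvent ends e s W) *
        prob p (Rplus ends e s T ∩ SEvent ends e s W) := by
  by_cases hsW : s ∈ W
  · by_cases hT : ∀ t ∈ T, t ∉ W
    · by_cases hu : u ∈ W <;> by_cases hw : w ∈ W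
      · exact term_le_of_both p ends e s T hends ⟨fun _ => hw, fun _ => hu⟩ hT a b
      · exact term_le_of_merge p ends e s T hp hends hu hw hT a b
      · exact term_le_of_merge p ends e s T hp (by rw [hends, Sym2.eq_swap]) hw hu hT a b
      · exact term_le_of_both p ends e s T hends
          ⟨fun h => absurd h hu, fun h => absurd h hw⟩ hT a b
    · obtain ⟨t, ht, htW⟩ : ∃ t ∈ T, t ∈ W := by
        by_contra hcon
        exact hT fun t ht htW => hcon ⟨t, ht, htW⟩
      have h0 := Rplus_inter_SEvent_eq_empty ends e s ht htW
      simp only [Set.inter_assoc, h0, Set.inter_empty, prob_empty, mul_zero, le_refl]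
  · rw [SEvent_eq_empty_of_notMem ends e s hsW]
    simp [prob_empty]

end Termwise

/-! ## The reduction -/

section Reduction

variable (p : E → R) (ends : E → Sym2 V) (e : E) (s : V) (T : Finset V)

/-- **The linearised joint mass is dominated by the joint mass**: `Ã₁ ≤ A₁ = P(X⁺ ∩ Y⁺ ∩ R⁺)`. -/
lemma linJoint_le (hp : IsProbVec p) (a b : V) :
    linJoint p ends e s T a b ≤
      prob p (Xplus ends e s a ∩ Xplus ends e s b ∩ Rplus ends e s T) := by
  obtain ⟨u, w, hends⟩ := exists_ends_eq ends e
  rw [prob_eq_sum_SEvent p ends e s (Xplus ends e s a ∩ Xplus ends e s b ∩ Rplus ends e s T)]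
  unfold linJoint
  refine Finset.sum_le_sum fun W _ => ?_
  rcases (prob_nonneg hp (Rplus ends e s T ∩ SEvent ends e s W)).lt_or_eq with hpos | hzero
  · rw [div_le_iff₀ hpos]
    exact term_le p ends e s T hp hends a b W
  · rw [← hzero, div_zero]
    exact prob_nonneg hp _

/-- **(L1-S) ⟹ (CC-T)** (mine-c §10.3, rigorous): the S-frame linearisation implies the first rung
`TwoSetRung.CC2 p ends e s {a} {b} T T`. -/
theorem CC2_of_L1S (hp : IsProbVec p) (a b : V) (h : L1S p ends e s T a b) :
    CC2 p ends e s {a} {b} T T := by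
  unfold CC2
  rw [Finset.inter_self, Finset.union_self, massF_update_one_pair_eq]
  unfold L1S at h
  have hle := linJoint_le p ends e s T hp a b
  have hP2 : 0 ≤ massP (Function.update p e 0) ends s T ^ 2 := sq_nonneg _
  nlinarith [h, mul_le_mul_of_nonneg_right hle hP2]

end Reduction

end SFrame

end Summit.Ventures.PercRepro2
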